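import Summits.AtomisticToContinuum.Crystallization.Theorems.FrustratedLawDichotomyStrainedPatchHomEntryLeafHTA2QCellB385S1

/-!
# THE `0.85 t_b` PRODUCTION CELL `cT085 × wB385`, part 2: ★★★ the certificate side `htCertSideA2Q pB385A2 QB385 GnB385 JT085 cT085 wB385 = true`
# (27623 `(H) HomFloor (1/625)`, hcp half; hand-1 g36)

decomp-a2c hand-1 g36.  KERNEL: `restB385A2`, `linB385A2` (`855519334368 ≤ 857000000000`), `farB385A2` (`899992428703 ≤ 906292000000`); with `…CellB385S1.qB385_0/1/2`: ★★★ `htCertSideA2Q_B385A2`.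

Kernel facts + assembly; 0 sorry; standard axioms; no definitions.  `--supports stmt-AtomisticToContinuum-27623`.
-/

namespace Summit.AtomisticToContinuum.Crystallization.Theorems.FrustratedLawDichotomyStrainedPatchHomEntryLeafHT

open Literature.Analysis.ValidatedNumerics.Numerics
open Summit.AtomisticToContinuum.Crystallization.Theorems.FrustratedLawDichotomyStrainedPatchHomCertTree (CertTree treeOK)
open Summit.AtomisticToContinuum.Crystallization.Theorems.FrustratedLawDichotomyStrainedPatchHomEntryTable (muRec)
open Summit.AtomisticToContinuum.Crystallization.Theorems.FrustratedLawDichotomyStrainedPatchHomEntryFitTolerance (cT085)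
open Summit.AtomisticToContinuum.Crystallization.Theorems.FrustratedLawDichotomyStrainedPatchHomSlopeLJ
open Summit.AtomisticToContinuum.Crystallization.Theorems.FrustratedLawDichotomyStrainedPatchHomSlopeLJAffine
open Summit.AtomisticToContinuum.Crystallization.Theorems.FrustratedLawDichotomyStrainedPatchHomSlopeLJAffine2Kit

set_option maxRecDepth 100000 in
set_option maxHeartbeats 4000000 in
/-- ★ KERNEL: the non-slope conjuncts of the certificate side at `cT085 × wB385`. -/
theorem restB385A2 : htCertRestA2 pB385A2 JT085 cT085 wB385 = true := by
  decide +kernel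

set_option maxRecDepth 100000 in
set_option maxHeartbeats 4000000 in
/-- ★ KERNEL: `g₀ + lin + ⌈√ΣQ²⌉ + rem3 + nai = 855519334368 ≤ GnB385`. -/
theorem linB385A2 : g0LJ cT085 (htScA2F cT085 wB385 JT085 (htNearU cT085 wB385)) + linLJA cT085 wB385 JT085 (htScA2F cT085 wB385 JT085 (htNearU cT085 wB385)) + sqrtQ QB385 +
    rem3LJ cT085 (hullW JT085 wB385) (htScA2F cT085 wB385 JT085 (htNearU cT085 wB385)) + naiSLJ cT085 (hullW JT085 wB385) (htSnA2F cT085 wB385 JT085 (htNearU cT085 wB385)) ≤ GnB385 := by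
  decide +kernel

set_option maxRecDepth 100000 in
set_option maxHeartbeats 4000000 in
/-- KERNEL: `GnB385 + far₁ + far₂ = 899992428703 ≤ Gs`. -/
theorem farB385A2 : GnB385 + htGsNA cT085 wB385 JT085 (htFar1U cT085 wB385) + htGsNA cT085 wB385 JT085 (htFar2U cT085 wB385) ≤ pB385A2.Gs := by
  decide +kernel

/-- ★★★ **THE SECOND-ORDER AFFINE CERTIFICATE SIDE OF THE `0.85 t_b` THREE-COARSE CELL HOLDS** (six kernel facts). [assembly] -/
theorem htCertSideA2Q_B385A2 : htCertSideA2Q pB385A2 QB385 GnB385 JT085 cT085 wB385 = true :=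
  htCertSideA2Q_of_parts restB385A2 qB385_0 qB385_1 qB385_2 linB385A2 farB385A2

end Summit.AtomisticToContinuum.Crystallization.Theorems.FrustratedLawDichotomyStrainedPatchHomEntryLeafHT
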